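import Mathlib.CategoryTheory.Limits.Types.Coproducts
import Literature.AnabelianGeometry.SemiGraphs.BTempPullbackOrbit
import Literature.AnabelianGeometry.SemiGraphs.TemperoidsHomFibre
import Literature.AnabelianGeometry.SemiGraphs.TemperoidsResProofs
import HarnessLib

/-!
# Semi-graphs of anabelioids, Appendix, proof of Theorem A.4: 0-PROPERNESS in `B^temp(Π)` —
# orbits are components, coprojections are injective, and a morphism of QD-pairs that is
# surjective on points (in particular any morphism onto a connected target) is 0-proper

Mochizuki, *Semi-graphs of anabelioids*, Publ. RIMS **42** (2006) 221–322, Appendix, Definition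
A.3 (ii) (manuscript p. 82: "If, moreover, `φ` induces a surjection `π₀(A) ↠ π₀(B)`, then we shall say
that this morphism is *0-proper*") and the proof of Theorem A.4 (pp. 83–84), where every 1-proper
morphism constructed ("`(B′, Γ_B′) → (B, Γ_B)` is a 1-proper morphism of strongly connected QD-pairs")
must in particular be 0-proper. [cite: MochizukiSemiAnbd2006, Def A.3(ii) p.82]
[cite: MochizukiSemiAnbd2006, Thm A.4 proof pp.83-84]

Proof-only helper (no definitions, no named facts) for the rows A4-S-dir / A4-S-real of
`HOME/plan/L3/SUBDAG-SemiAnbd-Cor311.md` (seat abc-iut-w5-d220; the `B^temp(Π)` analogue of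
abc-iut-w4-d048/w4-d110's `isZeroProper_iff_surjective` for `B^temp(Π, Π°)`,
`QuasiTemperoidsRmkA31Model.lean`), over abc-iut-w5-d129's orbit objects (`BTemp.orbitObj`,
`BTemp.orbitIncl`, `BTempPullbackOrbit.lean`):

* `BTemp.injective_of_isComponent` — a component `κ : D → X` of `B^temp(Π)` (Def. A.3's
  `IsComponent`: `D` connected, `κ` a coprojection of a binary coproduct) is injective on points
  (coproducts of `B^temp(Π)` are disjoint unions on points);
* `BTemp.isComponent_orbitIncl` — the orbit `Π · x₀ ⊆ X` with its inclusion IS a component of `X`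
  (`X = Π·x₀ ⊔ (X ∖ Π·x₀)` in `B^temp(Π)`);
* `QDPair.isZeroProper_of_surjective` — a morphism of QD-pairs of `B^temp(Π)` whose arrow is surjective
  on points is 0-proper: a component `D` of the target has a point, lift it to `x₀`; the orbit of
  `x₀` maps to `D` because `Stab(x₀)` fixes the chosen point of `D` (components are injective), and
  the square commutes;
* `QDPair.isZeroProper_of_isStronglyConnected` — in particular every morphism of QD-pairs whose
  target is strongly connected and whose source has a point is 0-proper (an equivariant map into a
  single orbit is onto).

`Π` is a topological group (`IsTopologicalGroup`, for the fibre functor of `B^temp(Π)`); no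
temperedness is needed.  Elementary; nothing refers to the IUT corpus; no side is taken on any
disputed claim.
-/

open CategoryTheory CategoryTheory.Limits

namespace Literature.AnabelianGeometry.SemiGraphs

open Literature.AlgebraicGeometry.Frobenioids (IsConnectedObj IsNonemptyObj)
open Literature.AlgebraicGeometry.Frobenioids.QuasiTemperoid.BTempConnected (hom_ρ hom_ext_apply
  ρ_one_apply ρ_mul_apply ρ_inv_apply nonempty_of_isConnectedObj surjective_of_isConnectedObj)

universe u

variable {G : Type u} [Group G] [TopologicalSpace G] [IsTopologicalGroup G]

namespace BTemp

/-! ### Coprojections of `B^temp(Π)` are injective -/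

/-- **A component of an object of `B^temp(Π)` is injective on points**: a coprojection `κ : D → X` of a
colimit binary cofan stays a coprojection of a coproduct of SETS under the fibre functor (which
preserves finite coproducts), and those are injective (`Types.binaryCofan_isColimit_iff`).
[cite: MochizukiSemiAnbd2006, Def A.3(ii) p.82] -/
theorem injective_of_isComponent {D X : BTemp G} {κ : D ⟶ X} (hκ : IsComponent κ) :
    Function.Injective fun d : D.obj.V => (κ.hom.hom d : X.obj.V) := by
  obtain ⟨-, D', κ', ⟨hc⟩⟩ := hκ
  let Φ := (temperedAction G).ι ⋙ Action.forget (Type u) G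
  haveI : PreservesColimitsOfShape (Discrete WalkingPair) Φ :=
    fibre_preservesColimitsOfShape G (Discrete WalkingPair)
  have hc' : IsColimit (BinaryCofan.mk (Φ.map κ) (Φ.map κ')) :=
    mapIsColimitOfPreservesOfIsColimit Φ κ κ' hc
  have h := ((Types.binaryCofan_isColimit_iff _).mp ⟨hc'⟩).1
  exact h

/-! ### Orbits are components -/

omit [IsTopologicalGroup G] in
/-- **The orbit of a point is a component**: `Π·x₀ ↪ X` is a coprojection of the decomposition
`X = Π·x₀ ⊔ (X ∖ Π·x₀)` in `B^temp(Π)` (the complement is `Π`-stable, countable with open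
stabilisers; the universal property is checked pointwise), and `Π·x₀` is connected
(`orbitObj_isConnectedObj`). [cite: MochizukiSemiAnbd2006, Def A.3(ii) p.82] -/
theorem isComponent_orbitIncl (X : BTemp G) (x₀ : X.obj.V) : IsComponent (orbitIncl X x₀) := by
  classical
  refine ⟨orbitObj_isConnectedObj X x₀, ?_⟩
  -- the complement of the orbit, as an object of `B^temp(Π)`
  let inOrbit : X.obj.V → Prop := fun y => ∃ a : G, X.obj.ρ a x₀ = y
  have hstab : ∀ (a : G) (y : X.obj.V), inOrbit y ↔ inOrbit (X.obj.ρ a y) := by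
    intro a y
    constructor
    · rintro ⟨b, hb⟩
      exact ⟨a * b, by rw [ρ_mul_apply, hb]⟩
    · rintro ⟨b, hb⟩
      refine ⟨a⁻¹ * b, ?_⟩
      rw [ρ_mul_apply, hb, ρ_inv_apply]
  let Dc : BTemp G :=
    ⟨{ V := {y : X.obj.V // ¬ inOrbit y}
       ρ := { toFun := fun a => TypeCat.ofHom fun y =>
                ⟨X.obj.ρ a y.1, fun h => y.2 ((hstab a y.1).mpr h)⟩
              map_one' := by
                refine ConcreteCategory.hom_ext _ _ fun y => Subtype.ext ?_
                exact ρ_one_apply X y.1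
              map_mul' := fun a b => by
                refine ConcreteCategory.hom_ext _ _ fun y => Subtype.ext ?_
                exact ρ_mul_apply X a b y.1 } }, by
      haveI : Countable X.obj.V := X.property.1
      refine ⟨Subtype.countable, fun y => ?_⟩
      have : {a : G | (TypeCat.ofHom fun z : {y : X.obj.V // ¬ inOrbit y} =>
            (⟨X.obj.ρ a z.1, fun h => z.2 ((hstab a z.1).mpr h)⟩ : {y : X.obj.V // ¬ inOrbit y})) y = y}
          = {a : G | X.obj.ρ a y.1 = y.1} := by
        ext a
        simp only [Set.mem_setOf_eq, TypeCat.ofHom_apply, Subtype.ext_iff]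
      exact this ▸ X.property.2 y.1⟩
  let κ' : Dc ⟶ X :=
    ObjectProperty.homMk { hom := TypeCat.ofHom fun y => y.1, comm := fun _ => rfl }
  refine ⟨Dc, κ', ⟨?_⟩⟩
  -- the universal property, pointwise
  let d : ∀ s : BinaryCofan (orbitObj X x₀) Dc, X.obj.V → s.pt.obj.V := fun s y =>
    if hy : inOrbit y then s.inl.hom.hom (⟨y, hy⟩ : (orbitObj X x₀).obj.V)
    else s.inr.hom.hom (⟨y, hy⟩ : Dc.obj.V)
  have hd₁ : ∀ s y (hy : inOrbit y), d s y = s.inl.hom.hom (⟨y, hy⟩ : (orbitObj X x₀).obj.V) :=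
    fun s y hy => by simp only [d, dif_pos hy]
  have hd₂ : ∀ s y (hy : ¬ inOrbit y), d s y = s.inr.hom.hom (⟨y, hy⟩ : Dc.obj.V) :=
    fun s y hy => by simp only [d, dif_neg hy]
  refine BinaryCofan.isColimitMk (fun s => ObjectProperty.homMk
      { hom := TypeCat.ofHom (d s)
        comm := fun g => ?_ }) ?_ ?_ ?_
  · apply ConcreteCategory.hom_ext
    intro y
    change d s (X.obj.ρ g y) = s.pt.obj.ρ g (d s y)
    by_cases hy : inOrbit y
    · rw [hd₁ s y hy, hd₁ s (X.obj.ρ g y) ((hstab g y).mp hy)]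
      exact hom_ρ s.inl g (⟨y, hy⟩ : (orbitObj X x₀).obj.V)
    · rw [hd₂ s y hy, hd₂ s (X.obj.ρ g y) (fun h => hy ((hstab g y).mpr h))]
      exact hom_ρ s.inr g (⟨y, hy⟩ : Dc.obj.V)
  · intro s
    apply hom_ext_apply
    intro y
    change d s (y.1 : X.obj.V) = s.inl.hom.hom y
    exact hd₁ s y.1 y.2
  · intro s
    apply hom_ext_apply
    intro y
    change d s (y.1 : X.obj.V) = s.inr.hom.hom y
    exact hd₂ s y.1 y.2
  · intro s m h₁ h₂
    apply hom_ext_apply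
    intro y
    change m.hom.hom y = d s y
    by_cases hy : inOrbit y
    · rw [hd₁ s y hy, ← h₁]
      rfl
    · rw [hd₂ s y hy, ← h₂]
      rfl

end BTemp

namespace QDPair

open BTemp

/-! ### 0-properness from surjectivity -/

/-- **A morphism of QD-pairs of `B^temp(Π)` that is surjective on points is 0-proper** (Def. A.3
(ii): it induces a surjection on connected components).  Given a component `κ : D → B` (connected,
hence with a point `d`), lift `κ d` to `x₀ ∈ A`; the orbit `Π·x₀` is a component of `A`
(`isComponent_orbitIncl`), it maps to `D` by `a·x₀ ↦ a·d` — well defined and equivariant because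
`κ` is injective (`injective_of_isComponent`) and `κ(a·d) = a·κ(d) = f(a·x₀)` — and the square
commutes. [cite: MochizukiSemiAnbd2006, Def A.3(ii) p.82] -/
theorem isZeroProper_of_surjective {P₁ P₂ : QDPair (BTemp G)} (f : P₁ ⟶ P₂)
    (hf : Function.Surjective fun x : P₁.A.obj.V => (f.hom.hom.hom x : P₂.A.obj.V)) :
    Hom.IsZeroProper f := by
  classical
  intro D κ hκ
  obtain ⟨d⟩ := nonempty_of_isConnectedObj D hκ.1
  obtain ⟨x₀, hx₀⟩ := hf (κ.hom.hom d)
  have hinj := injective_of_isComponent hκ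
  -- every point of the orbit of `x₀` maps into the image of `κ`
  have hex : ∀ y : (orbitObj P₁.A x₀).obj.V, ∃ d' : D.obj.V,
      (κ.hom.hom d' : P₂.A.obj.V) = f.hom.hom.hom y.1 := by
    intro y
    obtain ⟨a, ha⟩ := y.2
    refine ⟨D.obj.ρ a d, ?_⟩
    rw [hom_ρ, ← ha, hom_ρ f.hom a x₀]
    exact congrArg (P₂.A.obj.ρ a) hx₀.symm
  let hfun : (orbitObj P₁.A x₀).obj.V → D.obj.V := fun y => Classical.choose (hex y)
  have hfun_spec : ∀ y, (κ.hom.hom (hfun y) : P₂.A.obj.V) = f.hom.hom.hom y.1 :=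
    fun y => Classical.choose_spec (hex y)
  have hequiv : ∀ (g : G) (y : (orbitObj P₁.A x₀).obj.V),
      hfun ((orbitObj P₁.A x₀).obj.ρ g y) = D.obj.ρ g (hfun y) := by
    intro g y
    apply hinj
    change (κ.hom.hom (hfun ((orbitObj P₁.A x₀).obj.ρ g y)) : P₂.A.obj.V) =
      κ.hom.hom (D.obj.ρ g (hfun y))
    rw [hfun_spec, hom_ρ κ g, hfun_spec]
    change (f.hom.hom.hom (P₁.A.obj.ρ g y.1) : P₂.A.obj.V) = P₂.A.obj.ρ g (f.hom.hom.hom y.1)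
    exact hom_ρ f.hom g y.1
  refine ⟨orbitObj P₁.A x₀, orbitIncl P₁.A x₀, BTemp.homOfEquivariant _ _ hfun hequiv,
    isComponent_orbitIncl P₁.A x₀, ?_⟩
  apply hom_ext_apply
  intro y
  change (f.hom.hom.hom ((orbitIncl P₁.A x₀).hom.hom y) : P₂.A.obj.V) =
    κ.hom.hom ((BTemp.homOfEquivariant _ _ hfun hequiv).hom.hom y)
  rw [orbitIncl_apply, BTemp.homOfEquivariant_apply, hfun_spec]

/-- **Every morphism of QD-pairs onto a STRONGLY CONNECTED target is 0-proper**, provided the source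
has a point: an equivariant map into a single `Π`-orbit is surjective
(`surjective_of_isConnectedObj`). This is the case of the proof of Thm. A.4, where all covers
`(B′, Γ_B′) → (B, Γ_B)` have `B` connected. [cite: MochizukiSemiAnbd2006, Thm A.4 proof pp.83-84] -/
theorem isZeroProper_of_isStronglyConnected {P₁ P₂ : QDPair (BTemp G)} (f : P₁ ⟶ P₂)
    (h₁ : Nonempty P₁.A.obj.V) (h₂ : P₂.IsStronglyConnected) : Hom.IsZeroProper f := by
  obtain ⟨x₁⟩ := h₁
  exact isZeroProper_of_surjective f (surjective_of_isConnectedObj x₁ h₂ f.hom)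

end QDPair

end Literature.AnabelianGeometry.SemiGraphs
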